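import Mathlib.Analysis.Calculus.Deriv.Inv
import Mathlib.Analysis.SpecialFunctions.Pow.Asymptotics
import Literature.Barriers.AtomisticToContinuum.ShockFormationPropagation
import Literature.Barriers.AtomisticToContinuum.ShockFormationEstimates
import HarnessLib

/-!
# Sideris 1985, Theorem 1 — discharge of `ShockFormationBarrier`

Final file of the discharge of
`Literature.Barriers.AtomisticToContinuum.ShockFormationBarrier` (Sideris, Comm. Math. Phys.
101 (1985), Thm. 1: `C¹` solutions of the polytropic Euler equations with data satisfying
(1.2), (1.5 a–c) have finite life span). Following §2 of the paper verbatim: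

* the Proposition (`PolytropicEuler.FinitePropagationSpeed_holds`, file `…Propagation`) makes
  `(ρ - ρ̄, u, S - S̄)` supported in `B(t) = {‖x‖ ≤ R + σt}`;
* (2.1 c) `F' = ∫ (ρ‖u‖² + 3(p - p̄))` (file `…Identities`) and (2.2 a) `∫ (p - p̄) ≥ 0`
  (file `…Estimates`) give `F' ≥ ∫ ρ‖u‖²`;
* (2.2 b, c) `F² ≤ (R + σt)² (∫_B ρ) ∫ ρ‖u‖² ≤ (4π/3)(R + σt)⁵ max ρ⁰ · F'` (file `…Estimates`);
* (2.3) the Riccati inequality `F' ≥ ((4π/3) max ρ⁰ (R + σt)⁵)⁻¹ F²` with `F(0) > 0` forces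
  `F(0)⁻¹ > F(0)⁻¹ - F(T)⁻¹ ≥ (4σ · (4π/3) max ρ⁰)⁻¹ (R⁻⁴ - (R + σT)⁻⁴)` for every `T`, hence
  `F(0) ≤ (16π/3) σ R⁴ max ρ⁰`, contradicting (1.5 c) (`riccati_contradiction`, a statement about
  real functions; `T → ∞`).

## Mathlib search

`monotoneOn_of_deriv_nonneg`, `antitoneOn_of_deriv_nonpos`, `HasDerivAt.inv`,
`tendsto_inv_atTop_zero`, `le_of_tendsto'`. No definitions in this file.

## References

* T. C. Sideris, Comm. Math. Phys. 101 (1985) 475–485, Thm. 1 and §2 (2.1)–(2.3), pp. 477–480.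
-/

noncomputable section

open Set Function Filter MeasureTheory Metric
open scoped RealInnerProductSpace Topology

namespace Literature.Barriers.AtomisticToContinuum.PolytropicEuler

open Literature.Analysis.FluidPDE Literature.Analysis.FluidPDE.VectorCalculus

/-! ### (2.3): the Riccati inequality has no global positive solution -/

/-- Continuity on `[0, ∞)` from continuity on every `[0, T]`. [folklore] -/
theorem continuousOn_Ici_of_Icc {F : ℝ → ℝ} (hF : ∀ T, ContinuousOn F (Icc 0 T)) :
    ContinuousOn F (Ici 0) := by
  intro x hx
  have h1 : ContinuousWithinAt F (Icc 0 (x + 1)) x := hF (x + 1) x ⟨hx, by linarith⟩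
  refine h1.mono_of_mem_nhdsWithin ?_
  refine mem_nhdsWithin.2 ⟨Iio (x + 1), isOpen_Iio, by simp, ?_⟩
  rintro y ⟨hy1, hy2⟩
  exact ⟨hy2, (le_of_lt hy1)⟩

/-- **(2.3) Blow-up of the Riccati inequality.** There is no function `F`, continuous on
`[0, ∞)` and differentiable on `(0, ∞)` with `F' ≥ 0`, satisfying
`F(t)² ≤ c (R + σt)⁵ F'(t)` (`c, R, σ > 0`) and `F(0) > 4σ c R⁴`: such an `F` is nondecreasing, so
`F > 0`, and `t ↦ F(t)⁻¹ + (4σc)⁻¹(R⁻⁴ - (R + σt)⁻⁴)` is nonincreasing, whence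
`(4σc)⁻¹(R⁻⁴ - (R + σt)⁻⁴) < F(0)⁻¹` for all `t`; letting `t → ∞` gives `F(0) ≤ 4σ c R⁴`
(Sideris §2, (2.3) and the following display, `α = 16π/3` when `c = (4π/3) max ρ⁰`). [cite: Sideris1985, §2 (2.3)] -/
theorem riccati_contradiction {F Fd : ℝ → ℝ} {R σ c : ℝ} (hR : 0 < R) (hσ : 0 < σ) (hc : 0 < c)
    (hF : ∀ T, ContinuousOn F (Icc 0 T)) (hd : ∀ t, 0 < t → HasDerivAt F (Fd t) t)
    (hFd : ∀ t, 0 < t → 0 ≤ Fd t)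
    (hineq : ∀ t, 0 < t → F t ^ 2 ≤ c * (R + σ * t) ^ 5 * Fd t)
    (h0 : 4 * σ * c * R ^ 4 < F 0) : False := by
  have hcont : ContinuousOn F (Ici 0) := continuousOn_Ici_of_Icc hF
  -- `F` is nondecreasing, hence positive
  have hmono : MonotoneOn F (Ici 0) := by
    refine monotoneOn_of_deriv_nonneg (convex_Ici 0) hcont ?_ ?_
    · rw [interior_Ici]
      exact fun t ht => (hd t ht).differentiableAt.differentiableWithinAt
    · rw [interior_Ici]
      intro t ht
      rw [(hd t ht).deriv]
      exact hFd t ht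
  have hF0 : 0 < F 0 := lt_trans (by positivity) h0
  have hFpos : ∀ t, 0 ≤ t → 0 < F t := fun t ht =>
    hF0.trans_le (hmono (mem_Ici.2 le_rfl) (mem_Ici.2 ht) ht)
  -- the comparison function `K(t) = (4σc)⁻¹ (R⁻⁴ - (R + σt)⁻⁴)`, `K' = (c (R + σt)⁵)⁻¹`
  set K : ℝ → ℝ := fun t => (4 * σ * c)⁻¹ * ((R ^ 4)⁻¹ - ((R + σ * t) ^ 4)⁻¹) with hK
  have hrpos : ∀ t, 0 ≤ t → 0 < R + σ * t := fun t ht => by positivity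
  have hKd : ∀ t, 0 < t → HasDerivAt K ((c * (R + σ * t) ^ 5)⁻¹) t := by
    intro t ht
    have hr := hrpos t ht.le
    have h1 : HasDerivAt (fun s => R + σ * s) σ t := by
      simpa using ((hasDerivAt_id t).const_mul σ).const_add R
    have h2 : HasDerivAt (fun s => (R + σ * s) ^ 4) ((4 : ℕ) * (R + σ * t) ^ (4 - 1) * σ) t :=
      h1.pow 4
    have h3 := h2.inv (pow_ne_zero 4 hr.ne')
    have h4 := (h3.const_sub (R ^ 4)⁻¹).const_mul (4 * σ * c)⁻¹
    refine h4.congr_deriv ?_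
    field_simp
    ring
  -- `G = F⁻¹ + K` is nonincreasing on `[0, ∞)`
  set G : ℝ → ℝ := fun t => (F t)⁻¹ + K t with hG
  have hKc : ContinuousOn K (Ici 0) := by
    refine (continuousOn_const.mul (continuousOn_const.sub ?_))
    refine ContinuousOn.inv₀ (by fun_prop) fun t ht => pow_ne_zero 4 (hrpos t ht).ne'
  have hGc : ContinuousOn G (Ici 0) :=
    (hcont.inv₀ fun t ht => (hFpos t ht).ne').add hKc
  have hGd : ∀ t, 0 < t → HasDerivAt G (-(Fd t) / F t ^ 2 + (c * (R + σ * t) ^ 5)⁻¹) t :=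
    fun t ht => ((hd t ht).inv (hFpos t ht.le).ne').add (hKd t ht)
  have hanti : AntitoneOn G (Ici 0) := by
    refine antitoneOn_of_deriv_nonpos (convex_Ici 0) hGc ?_ ?_
    · rw [interior_Ici]
      exact fun t ht => (hGd t ht).differentiableAt.differentiableWithinAt
    · rw [interior_Ici]
      intro t ht
      rw [(hGd t ht).deriv]
      have hr := hrpos t (le_of_lt ht)
      have hF2 : 0 < F t ^ 2 := pow_pos (hFpos t (le_of_lt ht)) 2
      have hD : 0 < c * (R + σ * t) ^ 5 := by positivity
      -- `(c r⁵)⁻¹ ≤ Fd / F²` from `F² ≤ c r⁵ Fd`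
      have key : (c * (R + σ * t) ^ 5)⁻¹ ≤ Fd t / F t ^ 2 := by
        rw [inv_eq_one_div, div_le_div_iff₀ hD hF2]
        nlinarith [hineq t ht]
      have : -(Fd t) / F t ^ 2 = -(Fd t / F t ^ 2) := by ring
      rw [this]
      linarith
  -- hence `K t < F(0)⁻¹` for all `t ≥ 0`
  have hKlt : ∀ t, 0 ≤ t → K t ≤ (F 0)⁻¹ := by
    intro t ht
    have h1 : G t ≤ G 0 := hanti (mem_Ici.2 le_rfl) (mem_Ici.2 ht) ht
    have h2 : G 0 = (F 0)⁻¹ := by simp [hG, hK]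
    have h3 : 0 < (F t)⁻¹ := inv_pos.2 (hFpos t ht)
    simp only [hG] at h1 h2
    linarith
  -- let `t → ∞`: `(4σc)⁻¹ R⁻⁴ ≤ F(0)⁻¹`
  have hlim : Tendsto K atTop (𝓝 ((4 * σ * c)⁻¹ * ((R ^ 4)⁻¹ - 0))) := by
    have h1 : Tendsto (fun t => R + σ * t) atTop atTop :=
      tendsto_atTop_add_const_left atTop R (tendsto_id.const_mul_atTop hσ)
    have h2 : Tendsto (fun t => (R + σ * t) ^ 4) atTop atTop :=
      (tendsto_pow_atTop (by norm_num)).comp h1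
    have h3 : Tendsto (fun t => ((R + σ * t) ^ 4)⁻¹) atTop (𝓝 0) :=
      tendsto_inv_atTop_zero.comp h2
    exact (h3.const_sub _).const_mul _
  have hle : (4 * σ * c)⁻¹ * ((R ^ 4)⁻¹ - 0) ≤ (F 0)⁻¹ :=
    le_of_tendsto hlim (eventually_atTop.2 ⟨0, fun t ht => hKlt t ht⟩)
  rw [sub_zero, ← mul_inv, inv_le_inv₀ (by positivity) hF0] at hle
  linarith

/-! ### The main theorem -/

/-- **Sideris 1985, Theorem 1 (discharge of `ShockFormationBarrier`).** For `A > 0`, `γ > 1`,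
`R > 0`, `ρ̄ > 0` and initial data `(ρ⁰, u⁰, S⁰)` satisfying (1.2) and (1.5 a–c)
(`IsSiderisLargeData`), there is no `C¹` solution of the polytropic Euler system (1.1 a–d) on
`[0, ∞) × ℝ³` taking these data. Proof as printed (§2): by the Proposition the solution is the
rest state for `‖x‖ ≥ R + σt`; then (2.1 c), (2.2 a–c) give the Riccati inequality (2.3)
`F' ≥ ((4π/3) max ρ⁰ (R + σt)⁵)⁻¹ F²` for `F(t) = ∫ x·ρu` with `F(0) > (16π/3) σ R⁴ max ρ⁰ > 0`,
which no function on `[0, ∞)` satisfies (`riccati_contradiction`). Hypothesis (1.5 a) is not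
used (as in the printed proof of Theorem 1). [cite: Sideris1985, Theorem 1] -/
theorem _root_.Literature.Barriers.AtomisticToContinuum.ShockFormationBarrier_holds :
    ShockFormationBarrier := by
  intro A γ R ρbar Sbar hA hγ hR hρbar ρ₀ u₀ S₀ hdata hex
  obtain ⟨ρ, u, S, hsol, hρ0, hu0, hS0⟩ := hex
  have hγ0 : 0 < γ := zero_lt_one.trans hγ
  -- the far-field sound speed `σ > 0`
  set σ := farFieldSoundSpeed A γ ρbar Sbar with hσ_def
  have hσ0 : 0 < σ := by
    rw [hσ_def, farFieldSoundSpeed]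
    exact Real.sqrt_pos.2 (by positivity)
  -- the Proposition: rest beyond the front
  have hfar : ∀ x : E3, R ≤ ‖x‖ → ρ 0 x = ρbar ∧ u 0 x = 0 ∧ S 0 x = Sbar := by
    rw [hρ0, hu0, hS0]
    exact hdata.farField
  have hrest : ∀ t, 0 ≤ t → ∀ x : E3, R + σ * t ≤ ‖x‖ → ρ t x = ρbar ∧ u t x = 0 ∧ S t x = Sbar :=
    FinitePropagationSpeed_holds A γ R ρbar Sbar hA hγ hR hρbar ρ u S hsol hfar
  -- `max ρ⁰ > 0`
  set Mx : ℝ := ⨆ x, ρ₀ x with hMx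
  have hbdd : BddAbove (range ρ₀) := by
    have := bddAbove_range_density_zero hsol hfar
    rwa [hρ0] at this
  have hMx0 : 0 < Mx := (hdata.density_pos 0).trans_le (le_ciSup hbdd 0)
  -- the constants of (2.3)
  set c : ℝ := 4 * Real.pi / 3 * Mx with hc
  have hc0 : 0 < c := by positivity
  -- `F`, its derivative, and the estimates
  set F : ℝ → ℝ := radialMomentum ρ u with hF
  set Fd : ℝ → ℝ := fun t => (∫ x, ρ t x * ‖u t x‖ ^ 2) +
    3 * ∫ x, (polytropicPressure A γ (ρ t x) (S t x) - polytropicPressure A γ ρbar Sbar) with hFd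
  have hη : 0 ≤ entropyMassExcess γ ρbar Sbar ρ S 0 := by
    have := hdata.entropy_nonneg
    simp only [entropyMassExcess, hρ0, hS0]
    exact this
  have hP : ∀ t, 0 ≤ t → 0 ≤ ∫ x, (polytropicPressure A γ (ρ t x) (S t x) -
      polytropicPressure A γ ρbar Sbar) := fun t ht =>
    integral_pressure_sub_nonneg hsol hA hγ hρbar hR hσ0.le hrest hη ht
  have hkin : ∀ t, 0 ≤ t → 0 ≤ ∫ x, ρ t x * ‖u t x‖ ^ 2 := fun t ht =>
    integral_nonneg fun x => mul_nonneg (hsol.density_pos t ht x).le (sq_nonneg _)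
  refine riccati_contradiction (F := F) (Fd := Fd) hR hσ0 hc0 ?_ ?_ ?_ ?_ ?_
  · exact fun T => continuousOn_radialMomentum hsol hσ0.le hrest T
  · exact fun t ht => hasDerivAt_radialMomentum hsol hσ0.le hrest ht
  · intro t ht
    have := hP t ht.le
    have := hkin t ht.le
    simp only [hFd]
    positivity
  · -- (2.2 b, c): `F² ≤ (R + σt)² (∫_B ρ) ∫ρ‖u‖² ≤ c (R + σt)⁵ F'`
    intro t ht
    have hr : 0 ≤ R + σ * t := by positivity
    have h1 := sq_radialMomentum_le hsol hσ0.le hrest ht.le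
    have h2 : ∫ x in closedBall (0 : E3) (R + σ * t), ρ t x ≤
        (volume : Measure E3).real (closedBall (0 : E3) (R + σ * t)) * Mx := by
      rw [setIntegral_density_eq hsol hσ0.le hrest ht.le]
      have := setIntegral_density_zero_le hsol hfar (R + σ * t)
      simpa only [hMx, hρ0] using this
    rw [volume_real_closedBall_fin_three 0 hr] at h2
    have h3 : (∫ x, ρ t x * ‖u t x‖ ^ 2) ≤ Fd t := by
      simp only [hFd]
      linarith [hP t ht.le]
    have hb := hkin t ht.le
    calc F t ^ 2 ≤ ((R + σ * t) ^ 2 * ∫ x in closedBall (0 : E3) (R + σ * t), ρ t x) *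
          ∫ x, ρ t x * ‖u t x‖ ^ 2 := h1
      _ ≤ ((R + σ * t) ^ 2 * (4 * Real.pi / 3 * (R + σ * t) ^ 3 * Mx)) *
          ∫ x, ρ t x * ‖u t x‖ ^ 2 := by gcongr
      _ = c * (R + σ * t) ^ 5 * ∫ x, ρ t x * ‖u t x‖ ^ 2 := by simp only [hc]; ring
      _ ≤ c * (R + σ * t) ^ 5 * Fd t := by gcongr
  · -- (1.5 c): `F(0) > (16π/3) σ R⁴ max ρ⁰ = 4σ c R⁴`
    have h1 := hdata.radialMomentum_large
    rw [← radialMomentum_zero_eq hρ0 hu0] at h1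
    calc 4 * σ * c * R ^ 4 = 16 * Real.pi / 3 * σ * R ^ 4 * Mx := by simp only [hc]; ring
      _ < F 0 := h1

end Literature.Barriers.AtomisticToContinuum.PolytropicEuler

end
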